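import Mathlib.RingTheory.KrullDimension.Polynomial
import Mathlib.RingTheory.NoetherNormalization
import Mathlib.RingTheory.IntegralClosure.GoingDown
import Mathlib.RingTheory.Jacobson.Ring
import Mathlib.RingTheory.Polynomial.UniqueFactorization
import Literature.AlgebraicGeometry.Resolution.AffineDomainDimension
import HarnessLib

/-!
# Affine domains are equidimensional: `dim A_𝔪 = dim A` at every maximal ideal

Topic: `Literature/AlgebraicGeometry/Resolution`. PROVED over Mathlib: for a domain `A` of
finite type over a field `k` and a maximal ideal `𝔪 ⊆ A`, the height of `𝔪` is `dim A`, so the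
local ring `A_𝔪` has Krull dimension `dim A` (Matsumura, *Commutative Ring Theory*, §5:
Thm. 5.6 `dim A = tr.deg_k A`, Ex. 5.1 "`R = k[X₁, …, Xₙ]` and `P ∈ Spec R`; then
`ht P + coht P = n`"; affine domains are in fact equidimensional and catenary — only the weak
form "all maximal ideals have height `dim A`" is proved here). Proof: Noether normalization
`k[x₁, …, x_s] ↪ A` (finite, injective; Mathlib `exists_integral_inj_algHom_of_fg`); the
contraction `𝔫` of `𝔪` is maximal of height `s` (heights of maximal ideals of polynomial rings,
Mathlib `Polynomial.height_eq_height_add_one`, by induction on `s` through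
`MvPolynomial.finSuccEquiv` and the Nullstellensatz `Polynomial.isMaximal_comap_C_of_isJacobsonRing`);
a chain of primes of length `s` below `𝔫` lifts to one below `𝔪` by GOING DOWN for the integral
extension of the integrally closed domain `k[x]` (Mathlib's instance in
`RingTheory/IntegralClosure/GoingDown`); and `dim A = dim k[x] = s`.

Used by `LUAssembly.lean` (the local rings at the closed points of the Zariski–Riemann space of
a three-dimensional affine model have dimension three).

* `MvPolynomial.height_eq_of_isMaximal` — maximal ideals of `k[x₁, …, xₙ]` have height `n`;
* `height_eq_ringKrullDim_of_isMaximal` — maximal ideals of an affine domain have height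
  `dim A`; `ringKrullDim_localization_atPrime_eq_of_isMaximal` — `dim A_𝔪 = dim A`.

## References

* H. Matsumura, *Commutative Ring Theory*, CUP 1986, §5: Thm. 5.6 (p. 45), Ex. 5.1 (p. 49);
  §9 Thm. 9.4 (going down). [Matsumura1987]
-/

noncomputable section

namespace Literature.AlgebraicGeometry.Resolution

universe u

open Polynomial Ideal

/-- **Maximal ideals of `k[x₁, …, xₙ]` have height `n`** (induction on `n`: a maximal ideal of
`B[X]`, `B = k[x₁, …, xₙ]` Jacobson, contracts to a maximal ideal of `B`, and then has height
one more, Mathlib `Polynomial.height_eq_height_add_one`; Matsumura §5, Ex. 5.1 with `coht P = 0`).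
[cite: Matsumura1987, §5 Ex. 5.1] -/
theorem MvPolynomial.height_eq_of_isMaximal (k : Type u) [Field k] :
    ∀ (n : ℕ) (M : Ideal (MvPolynomial (Fin n) k)) [M.IsMaximal], M.height = n := by
  intro n
  induction n with
  | zero =>
    intro M hM
    have h1 : (M.height : WithBot ℕ∞) ≤ ringKrullDim (MvPolynomial (Fin 0) k) :=
      Ideal.height_le_ringKrullDim_of_isPrime
    rw [MvPolynomial.ringKrullDim_of_isNoetherianRing, ringKrullDim_eq_zero_of_field] at h1
    simp only [Nat.card_eq_fintype_card, Fintype.card_fin, Nat.cast_zero, add_zero] at h1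
    have h2 : M.height ≤ 0 := by exact_mod_cast h1
    rw [Nat.cast_zero]
    exact le_antisymm h2 bot_le
  | succ n ih =>
    intro M hM
    let e := (MvPolynomial.finSuccEquiv k n).toRingEquiv
    set M' : Ideal (Polynomial (MvPolynomial (Fin n) k)) := M.map e with hM'
    haveI : M'.IsMaximal := Ideal.map_isMaximal_of_equiv e
    set p : Ideal (MvPolynomial (Fin n) k) := M'.comap (C : _ →+* _) with hp
    haveI : p.IsMaximal := Polynomial.isMaximal_comap_C_of_isJacobsonRing M'
    haveI : M'.LiesOver p := ⟨by rw [Ideal.under_def, Polynomial.algebraMap_eq]⟩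
    have h1 : M'.height = p.height + 1 := Polynomial.height_eq_height_add_one p M'
    rw [ih p] at h1
    rw [← e.height_map M, ← hM', h1]
    norm_cast

/-- **Maximal ideals of affine domains have height `dim A`**: for a domain `A` of finite type
over a field every maximal ideal has height `dim A` (`= tr.deg`, Matsumura Thm. 5.6; the height
statement is Ex. 5.1 for polynomial rings, transported by Noether normalization and going down,
Matsumura Thm. 9.4 (ii)). [cite: Matsumura1987, §5 Thm. 5.6 and Ex. 5.1] -/
theorem height_eq_ringKrullDim_of_isMaximal (k : Type u) {A : Type u} [Field k] [CommRing A]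
    [IsDomain A] [Algebra k A] [Algebra.FiniteType k A] (m : Ideal A) [m.IsMaximal] :
    (m.height : WithBot ℕ∞) = ringKrullDim A := by
  obtain ⟨s, g, hinj, hint⟩ := exists_integral_inj_algHom_of_fg k A
  -- `A` as an integral extension of the integrally closed domain `B = k[x₁, …, x_s]`
  let B := MvPolynomial (Fin s) k
  letI : Algebra B A := g.toRingHom.toAlgebra
  have halg : ∀ b : B, algebraMap B A b = g b := fun _ => rfl
  haveI : Algebra.IsIntegral B A := ⟨fun a => hint a⟩
  haveI : FaithfulSMul B A := (faithfulSMul_iff_algebraMap_injective B A).mpr hinj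
  -- the contraction `𝔫` of `𝔪` is maximal, of height `s`
  let n : Ideal B := m.comap (algebraMap B A)
  haveI : n.IsMaximal := isMaximal_comap_of_isIntegral_of_isMaximal m
  have hn : n.height = s := MvPolynomial.height_eq_of_isMaximal k s n
  -- a chain of length `s` below `𝔫` lifts to one below `𝔪` (going down)
  obtain ⟨l, hlast, hlen⟩ := Ideal.exists_ltSeries_length_eq_height n
  haveI : m.LiesOver l.last.asIdeal := ⟨by rw [hlast]⟩
  obtain ⟨L, hL, hLlast, -⟩ := Ideal.exists_ltSeries_of_hasGoingDown l m
  have hge : (s : ℕ∞) ≤ m.height := by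
    have h1 : (L.length : ℕ∞) ≤ Order.height L.last := Order.length_le_height_last
    rw [hLlast, ← PrimeSpectrum.height_eq_orderHeight] at h1
    change (L.length : ℕ∞) ≤ m.height at h1
    rw [hL] at h1
    have h2 : (l.length : ℕ∞) = n.height := by exact_mod_cast hlen
    rw [h2, hn] at h1
    exact h1
  -- `dim A = dim B = s`
  have hdim : ringKrullDim A = s := by
    rw [ringKrullDim_eq_of_isIntegral (R := B) (S := A) hinj,
      MvPolynomial.ringKrullDim_of_isNoetherianRing, ringKrullDim_eq_zero_of_field]
    simp
  apply le_antisymm Ideal.height_le_ringKrullDim_of_isPrime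
  rw [hdim]
  exact_mod_cast hge

/-- Hence **`dim A_𝔪 = dim A`** for every maximal ideal `𝔪` of an affine domain `A`
(equidimensionality of affine domains at closed points). [cite: Matsumura1987, §5 Thm. 5.6 and Ex. 5.1] -/
theorem ringKrullDim_localization_atPrime_eq_of_isMaximal (k : Type u) {A : Type u} [Field k]
    [CommRing A] [IsDomain A] [Algebra k A] [Algebra.FiniteType k A] (m : Ideal A) [m.IsMaximal] :
    ringKrullDim (Localization.AtPrime m) = ringKrullDim A := by
  rw [IsLocalization.AtPrime.ringKrullDim_eq_height m (Localization.AtPrime m),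
    height_eq_ringKrullDim_of_isMaximal k m]

end Literature.AlgebraicGeometry.Resolution

end
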